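import Summits.CriticalPhenomena.CardyFormulaZ2.Theses.CardyFlipRusso

/-!
# `LegsGiveTarget` (item stmt-CriticalPhenomena-14154) — proved

The support item `LegsGiveTarget` of route `CardyFlipRusso` (sub-problem `CardyFormulaZ2`) is the
glue `SmirnovCardyTri → VoronoiHubFromSmirnov → SquareFromVoronoiHub → Target`: Smirnov's theorem
fed through the two transfer cruxes `VoronoiHubFromSmirnov` (site-`𝕋` → annealed Poisson–Voronoi)
and `SquareFromVoronoiHub` (Poisson–Voronoi → site percolation on the centred square lattice `G_s`)
yields both conjuncts of the route's `Target`.  The conclusion of `VoronoiHubFromSmirnov` is,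
verbatim, the first conjunct of `Target` and the hypothesis of `SquareFromVoronoiHub`, whose
conclusion is the second conjunct, so the proof is pure logic:
`Target = ⟨hHub hS, hSq (hHub hS)⟩`.
-/

namespace Summit.CriticalPhenomena.CardyFormulaZ2.Theorems

/-- **`LegsGiveTarget`** (route `CardyFlipRusso`, item stmt-CriticalPhenomena-14154): Smirnov's
theorem `SmirnovCardyTri`, the hub transfer `VoronoiHubFromSmirnov` and the square transfer
`SquareFromVoronoiHub` together give the route's `Target` (Cardy's formula for annealed
Poisson–Voronoi percolation and for site percolation on the centred square lattice).  Pure logic: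
the first conjunct is `hHub hS`, the second is `hSq (hHub hS)`. -/
theorem legsGiveTarget_proof :
    Summit.CriticalPhenomena.CardyFormulaZ2.Theses.CardyFlipRusso.LegsGiveTarget := by
  unfold Summit.CriticalPhenomena.CardyFormulaZ2.Theses.CardyFlipRusso.LegsGiveTarget
  intro hS hHub hSq
  exact ⟨hHub hS, hSq (hHub hS)⟩

end Summit.CriticalPhenomena.CardyFormulaZ2.Theorems
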